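import Literature.NumberTheory.LFunctions.FordKsLs
import HarnessLib

/-!
# Ford's Lemma 3.2 (general `d`), part A: coincidences (`S₂`) and the prime pigeonhole (`S₁ → S₃`)

Topic `Literature/NumberTheory/LFunctions`. Everything here is PROVED.

K. Ford, Proc. LMS 85 (2002), proof of Lemma 3.2, first two steps, for the counts `K_s` of
`FordKsLs`:

* `S₂` (a coincidence `z_i = z_j` or `w_i = w_j`): by Hölder,
  `N ≤ K^{1−1/k} (K(2Ψ) J_{s,k}(Q))^{1/(2k)}` for the number `N` of solutions with `z_0 = z_1`
  (`FordVK.coincidence_le`), whence `K ≤ 2 S₁` for a *maximal* system when `P > 4k⁴`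
  (`FordVK.Ks_le_two_S1`);
* `S₁` (both `z` and `w` injective): each such solution is counted by `S₃(p)` for some prime of a
  set `𝒫` with `∏ 𝒫 > P^{k²−k}` (`FordVK.S1_le_sum_S3`).

## References

* K. Ford, Proc. London Math. Soc. (3) 85 (2002), 565–633, proof of Lemma 3.2 up to (3.3).
  [Ford2002]
-/

noncomputable section

open Finset MeasureTheory Polynomial Complex
open scoped Real ComplexConjugate

namespace Literature.NumberTheory.LFunctions
namespace FordVK

open VMV

/-! ### The doubled system and the basic sums -/

/-- `sysv (2Ψ) = 2 • sysv Ψ`. [folklore] -/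
theorem sysv_doubleSys {k : ℕ} (Ψ : PSystem k) (z : ℤ) : sysv (doubleSys Ψ) z = 2 • sysv Ψ z := by
  funext j; simp [sysv, doubleSys_eval, two_mul]

section Sums

variable {k : ℕ} (s P Q : ℕ) (Ψ : PSystem k) (q : ℤ)

/-- `|F(α)|` with `F(α) = ∑_{z ≤ P} e(α·Ψ(z))`. [cite: Ford2002, §3] -/
def absF (α : Fin k → ℝ) : ℝ := ‖tp (Finset.Icc 1 (P : ℤ)) (sysv Ψ) α‖
/-- `|F₂(α)|`, the doubled system. [cite: Ford2002, proof of Lemma 3.2] -/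
def absF2 (α : Fin k → ℝ) : ℝ := ‖tp (Finset.Icc 1 (P : ℤ)) (sysv (doubleSys Ψ)) α‖
/-- `|f(α)|` with `f(α) = ∑_{x ≤ Q} e(α₁qx + ⋯ + α_k q^k x^k)`. [cite: Ford2002, §3] -/
def absf (α : Fin k → ℝ) : ℝ := ‖tp (Finset.Icc 1 (Q : ℤ)) (powv k q) α‖

omit s Q q in
/-- Auxiliary step (elementary consequence of the standing hypotheses). [folklore] -/
theorem absF_nonneg (α : Fin k → ℝ) : 0 ≤ absF P Ψ α := norm_nonneg _
omit s Q q in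
/-- Auxiliary step (elementary consequence of the standing hypotheses). [folklore] -/
theorem absF2_nonneg (α : Fin k → ℝ) : 0 ≤ absF2 P Ψ α := norm_nonneg _
omit s P Ψ in
/-- Auxiliary step (elementary consequence of the standing hypotheses). [folklore] -/
theorem absf_nonneg (α : Fin k → ℝ) : 0 ≤ absf Q q α := norm_nonneg _
omit s Q q in
/-- Auxiliary step (elementary consequence of the standing hypotheses). [folklore] -/
theorem continuous_absF : Continuous (absF P Ψ) := (continuous_tp _ _).norm
omit s Q q in
/-- Auxiliary step (elementary consequence of the standing hypotheses). [folklore] -/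
theorem continuous_absF2 : Continuous (absF2 P Ψ) := (continuous_tp _ _).norm
omit s P Ψ in
/-- Auxiliary step (elementary consequence of the standing hypotheses). [folklore] -/
theorem continuous_absf : Continuous (absf (k := k) Q q) := (continuous_tp _ _).norm

/-- `K = ∫ |F|^{2k} |f|^{2s}`. [folklore] -/
theorem Ks_eq_integral' : (Ks s P Q Ψ q : ℝ) = ∫ α in box k, absF P Ψ α ^ (2 * k) * absf Q q α ^ (2 * s) :=
  Ks_eq_integral s P Q Ψ q

/-- `K(2Ψ) = ∫ |F₂|^{2k} |f|^{2s}`. [folklore] -/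
theorem Ks_double_eq_integral :
    (Ks s P Q (doubleSys Ψ) q : ℝ) = ∫ α in box k, absF2 P Ψ α ^ (2 * k) * absf Q q α ^ (2 * s) :=
  Ks_eq_integral s P Q (doubleSys Ψ) q

/-- `J_{s,k}(Q) = ∫ |f|^{2s}` (`q ≠ 0`). [cite: Ford2002, (1.3)–(1.4)] -/
theorem J_eq_integral_absf {q} (hq : q ≠ 0) :
    (J k s (Finset.Icc 1 (Q : ℤ)) : ℝ) = ∫ α in box k, absf Q q α ^ (2 * s) := by
  have h := integral_norm_sq_tp (n := k) (tuples s (Finset.Icc 1 (Q : ℤ))) (tupSum (powv k q))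
  unfold J Jc
  have e : ((tuples s (Finset.Icc 1 (Q : ℤ)) ×ˢ tuples s (Finset.Icc 1 (Q : ℤ))).filter
        (fun xy => psv k xy.1 = psv k xy.2 + 0))
      = ((tuples s (Finset.Icc 1 (Q : ℤ)) ×ˢ tuples s (Finset.Icc 1 (Q : ℤ))).filter
        (fun ii' => tupSum (powv k q) ii'.1 = tupSum (powv k q) ii'.2)) := by
    refine Finset.filter_congr fun xy _ => ?_
    rw [add_zero, tupSum_powv_eq_iff hq]
  rw [e, ← h]
  refine setIntegral_congr_fun (measurableSet_box k) fun α _ => ?_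
  simp only [absf]
  rw [tp_tuples_tupSum, norm_pow, ← pow_mul, mul_comm s 2]

end Sums

/-! ### Hölder: the three-factor inequality -/

/-- `∫ Φ₂ Φ^{2k−2} φ^{2s} ≤ (∫Φ^{2k}φ^{2s})^{1−1/k} (∫Φ₂^{2k}φ^{2s})^{1/(2k)} (∫φ^{2s})^{1/(2k)}` for continuous
nonnegative `Φ, Φ₂, φ` on `[0,1]^n`, `k ≥ 2`. [cite: Ford2002, proof of Lemma 3.2 (the Hölder display in
the case `S₂ ≥ S₁`)] -/
theorem holder_three {n k s : ℕ} (hk : 2 ≤ k) {Φ Φ₂ φ : (Fin n → ℝ) → ℝ} (hΦ : Continuous Φ)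
    (hΦ₂ : Continuous Φ₂) (hφ : Continuous φ) (hΦ0 : ∀ α, 0 ≤ Φ α) (hΦ₂0 : ∀ α, 0 ≤ Φ₂ α) (hφ0 : ∀ α, 0 ≤ φ α) :
    ∫ α in box n, Φ₂ α * Φ α ^ (2 * k - 2) * φ α ^ (2 * s)
      ≤ (∫ α in box n, Φ α ^ (2 * k) * φ α ^ (2 * s)) ^ (1 - 1 / (k : ℝ))
        * (∫ α in box n, Φ₂ α ^ (2 * k) * φ α ^ (2 * s)) ^ (1 / (2 * (k : ℝ)))
        * (∫ α in box n, φ α ^ (2 * s)) ^ (1 / (2 * (k : ℝ))) := by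
  have hkR : (2 : ℝ) ≤ k := by exact_mod_cast hk
  have hk0 : (0 : ℝ) < k := by linarith
  have hk1 : (0 : ℝ) < k - 1 := by linarith
  -- Step 1: Hölder with `p = k/(k−1)`, `q = k`
  set G₁ : (Fin n → ℝ) → ℝ := fun α => Φ α ^ (2 * k - 2) * φ α ^ (2 * (s : ℝ) * (k - 1) / k) with hG₁
  set G₂ : (Fin n → ℝ) → ℝ := fun α => Φ₂ α * φ α ^ (2 * (s : ℝ) / k) with hG₂
  have hG₁0 : ∀ α, 0 ≤ G₁ α := fun α => mul_nonneg (pow_nonneg (hΦ0 α) _) (Real.rpow_nonneg (hφ0 α) _)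
  have hG₂0 : ∀ α, 0 ≤ G₂ α := fun α => mul_nonneg (hΦ₂0 α) (Real.rpow_nonneg (hφ0 α) _)
  have hG₁c : Continuous G₁ := (hΦ.pow _).mul (hφ.rpow_const fun _ => Or.inr (by positivity))
  have hG₂c : Continuous G₂ := hΦ₂.mul (hφ.rpow_const fun _ => Or.inr (by positivity))
  have hpq : ((k : ℝ) / (k - 1)).HolderConjugate (k : ℝ) := by
    rw [Real.holderConjugate_iff]
    refine ⟨by rw [lt_div_iff₀ hk1]; linarith, ?_⟩
    field_simp
    ring
  have hprod : ∀ α, Φ₂ α * Φ α ^ (2 * k - 2) * φ α ^ (2 * s) = G₁ α * G₂ α := by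
    intro α
    simp only [hG₁, hG₂]
    have e : φ α ^ (2 * s) = φ α ^ (2 * (s : ℝ) * (k - 1) / k) * φ α ^ (2 * (s : ℝ) / k) := by
      rw [← Real.rpow_add_of_nonneg (hφ0 α) (by positivity) (by positivity),
        show (2 * (s : ℝ) * (k - 1) / k + 2 * (s : ℝ) / k) = ((2 * s : ℕ) : ℝ) by push_cast; field_simp; ring,
        Real.rpow_natCast]
    rw [e]; ring
  have step1 := holder_box hG₁c hG₂c hG₁0 hG₂0 hpq
  simp_rw [← hprod] at step1
  -- identify `G₁^{k/(k−1)}` and `G₂^k`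
  have hG₁pow : ∀ α, G₁ α ^ ((k : ℝ) / (k - 1)) = Φ α ^ (2 * k) * φ α ^ (2 * s) := by
    intro α
    simp only [hG₁]
    rw [Real.mul_rpow (pow_nonneg (hΦ0 α) _) (Real.rpow_nonneg (hφ0 α) _), ← Real.rpow_natCast,
      ← Real.rpow_mul (hΦ0 α), ← Real.rpow_mul (hφ0 α)]
    have e1 : ((2 * k - 2 : ℕ) : ℝ) * ((k : ℝ) / (k - 1)) = ((2 * k : ℕ) : ℝ) := by
      rw [Nat.cast_sub (by omega)]; push_cast; field_simp
    have e2 : 2 * (s : ℝ) * (k - 1) / k * ((k : ℝ) / (k - 1)) = ((2 * s : ℕ) : ℝ) := by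
      push_cast; field_simp
    rw [e1, e2, Real.rpow_natCast, Real.rpow_natCast]
  have hG₂pow : ∀ α, G₂ α ^ (k : ℝ) = Φ₂ α ^ k * φ α ^ (2 * s) := by
    intro α
    simp only [hG₂]
    rw [Real.mul_rpow (hΦ₂0 α) (Real.rpow_nonneg (hφ0 α) _), Real.rpow_natCast, ← Real.rpow_mul (hφ0 α)]
    have e : 2 * (s : ℝ) / k * k = ((2 * s : ℕ) : ℝ) := by push_cast; field_simp
    rw [e, Real.rpow_natCast]
  simp_rw [hG₁pow, hG₂pow] at step1
  -- Step 2: Cauchy–Schwarz for `∫ Φ₂^k φ^{2s}`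
  have step2 : ∫ α in box n, Φ₂ α ^ k * φ α ^ (2 * s)
      ≤ (∫ α in box n, Φ₂ α ^ (2 * k) * φ α ^ (2 * s)) ^ (1 / 2 : ℝ) * (∫ α in box n, φ α ^ (2 * s)) ^ (1 / 2 : ℝ) := by
    have h := holder_box (F := fun α => Φ₂ α ^ k * φ α ^ s) (G := fun α => φ α ^ s)
      ((hΦ₂.pow _).mul (hφ.pow _)) (hφ.pow _) (fun α => mul_nonneg (pow_nonneg (hΦ₂0 α) _) (pow_nonneg (hφ0 α) _))
      (fun α => pow_nonneg (hφ0 α) _) Real.HolderConjugate.two_two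
    have e1 : ∀ α, Φ₂ α ^ k * φ α ^ s * φ α ^ s = Φ₂ α ^ k * φ α ^ (2 * s) := fun α => by ring
    have e2 : ∀ α, (Φ₂ α ^ k * φ α ^ s) ^ (2 : ℝ) = Φ₂ α ^ (2 * k) * φ α ^ (2 * s) := fun α => by
      rw [show (2 : ℝ) = ((2 : ℕ) : ℝ) by norm_num, Real.rpow_natCast]; ring
    have e3 : ∀ α, (φ α ^ s) ^ (2 : ℝ) = φ α ^ (2 * s) := fun α => by
      rw [show (2 : ℝ) = ((2 : ℕ) : ℝ) by norm_num, Real.rpow_natCast]; ring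
    simp_rw [e1, e2, e3] at h
    exact h
  -- combine
  set K₁ := ∫ α in box n, Φ α ^ (2 * k) * φ α ^ (2 * s) with hK₁
  set K₂ := ∫ α in box n, Φ₂ α ^ (2 * k) * φ α ^ (2 * s) with hK₂
  set J₀ := ∫ α in box n, φ α ^ (2 * s) with hJ₀
  set I₂ := ∫ α in box n, Φ₂ α ^ k * φ α ^ (2 * s) with hI₂
  have hK₂0 : 0 ≤ K₂ := setIntegral_nonneg (measurableSet_box n) fun α _ =>
    mul_nonneg (pow_nonneg (hΦ₂0 α) _) (pow_nonneg (hφ0 α) _)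
  have hJ₀0 : 0 ≤ J₀ := setIntegral_nonneg (measurableSet_box n) fun α _ => pow_nonneg (hφ0 α) _
  have hI₂0 : 0 ≤ I₂ := setIntegral_nonneg (measurableSet_box n) fun α _ =>
    mul_nonneg (pow_nonneg (hΦ₂0 α) _) (pow_nonneg (hφ0 α) _)
  have hK₁0 : 0 ≤ K₁ := setIntegral_nonneg (measurableSet_box n) fun α _ =>
    mul_nonneg (pow_nonneg (hΦ0 α) _) (pow_nonneg (hφ0 α) _)
  calc ∫ α in box n, Φ₂ α * Φ α ^ (2 * k - 2) * φ α ^ (2 * s)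
      ≤ K₁ ^ (1 / ((k : ℝ) / (k - 1))) * I₂ ^ (1 / (k : ℝ)) := step1
    _ ≤ K₁ ^ (1 / ((k : ℝ) / (k - 1))) * ((K₂ ^ (1 / 2 : ℝ) * J₀ ^ (1 / 2 : ℝ)) ^ (1 / (k : ℝ))) := by
        refine mul_le_mul_of_nonneg_left (Real.rpow_le_rpow hI₂0 step2 (by positivity)) (Real.rpow_nonneg hK₁0 _)
    _ = K₁ ^ (1 - 1 / (k : ℝ)) * K₂ ^ (1 / (2 * (k : ℝ))) * J₀ ^ (1 / (2 * (k : ℝ))) := by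
        rw [Real.mul_rpow (Real.rpow_nonneg hK₂0 _) (Real.rpow_nonneg hJ₀0 _), ← Real.rpow_mul hK₂0,
          ← Real.rpow_mul hJ₀0]
        have e1 : 1 / ((k : ℝ) / (k - 1)) = 1 - 1 / (k : ℝ) := by field_simp
        have e2 : (1 / 2 : ℝ) * (1 / (k : ℝ)) = 1 / (2 * (k : ℝ)) := by field_simp
        rw [e1, e2]; ring

/-! ### Solution sets -/

section SolSets

variable {k : ℕ} (s P Q : ℕ) (Ψ : PSystem k) (q : ℤ)

/-- The solution set of (3.1) (so that `K_s = #Sol`). [cite: Ford2002, (3.1)] -/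
def Sol : Finset (((Fin k → ℤ) × (Fin s → ℤ)) × ((Fin k → ℤ) × (Fin s → ℤ))) :=
  ((KI k s P Q) ×ˢ (KI k s P Q)).filter fun p => Kfreq Ψ q p.1 = Kfreq Ψ q p.2

/-- Auxiliary step (elementary consequence of the standing hypotheses). [folklore] -/
theorem card_Sol : (Sol s P Q Ψ q).card = Ks s P Q Ψ q := rfl

/-- Auxiliary step (elementary consequence of the standing hypotheses). [folklore] -/
theorem mem_Sol {a} : a ∈ Sol s P Q Ψ q ↔ (a.1 ∈ KI k s P Q ∧ a.2 ∈ KI k s P Q) ∧ Kfreq Ψ q a.1 = Kfreq Ψ q a.2 := by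
  rw [Sol, mem_filter, mem_product]

/-- `S₁`: both `z` and `w` injective. [cite: Ford2002, proof of Lemma 3.2 (definition of `S₁`)] -/
def Sol1 : Finset (((Fin k → ℤ) × (Fin s → ℤ)) × ((Fin k → ℤ) × (Fin s → ℤ))) :=
  (Sol s P Q Ψ q).filter fun a => Function.Injective a.1.1 ∧ Function.Injective a.2.1

/-- The solutions with the coincidence `z_i = z_j`. [cite: Ford2002, proof of Lemma 3.2 (`S₂`)] -/
def SolZ (i j : Fin k) : Finset (((Fin k → ℤ) × (Fin s → ℤ)) × ((Fin k → ℤ) × (Fin s → ℤ))) :=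
  (Sol s P Q Ψ q).filter fun a => a.1.1 i = a.1.1 j

/-- The solutions with the coincidence `w_i = w_j`. [cite: Ford2002, proof of Lemma 3.2 (`S₂`)] -/
def SolW (i j : Fin k) : Finset (((Fin k → ℤ) × (Fin s → ℤ)) × ((Fin k → ℤ) × (Fin s → ℤ))) :=
  (Sol s P Q Ψ q).filter fun a => a.2.1 i = a.2.1 j

/-- Symmetry `z ↔ w`: `#SolW i j = #SolZ i j`. [folklore] -/
theorem card_SolW_eq (i j : Fin k) : (SolW s P Q Ψ q i j).card = (SolZ s P Q Ψ q i j).card := by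
  refine card_bij' (fun a _ => (a.2, a.1)) (fun a _ => (a.2, a.1)) ?_ ?_ (fun a _ => rfl) (fun a _ => rfl)
  · intro a ha
    rw [SolW, mem_filter, mem_Sol] at ha
    rw [SolZ, mem_filter, mem_Sol]
    exact ⟨⟨⟨ha.1.1.2, ha.1.1.1⟩, ha.1.2.symm⟩, ha.2⟩
  · intro a ha
    rw [SolZ, mem_filter, mem_Sol] at ha
    rw [SolW, mem_filter, mem_Sol]
    exact ⟨⟨⟨ha.1.1.2, ha.1.1.1⟩, ha.1.2.symm⟩, ha.2⟩

/-- Re-indexing the `z`-coordinates by a permutation preserves `KI` membership. [folklore] -/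
theorem comp_perm_mem_KI {σ : Equiv.Perm (Fin k)} {zx : (Fin k → ℤ) × (Fin s → ℤ)} (h : zx ∈ KI k s P Q) :
    (zx.1 ∘ σ, zx.2) ∈ KI k s P Q := by
  rw [mem_KI] at h ⊢; exact ⟨fun i => h.1 _, h.2⟩

/-- Re-indexing the `z`-coordinates preserves the total frequency. [folklore] -/
theorem Kfreq_comp_perm (σ : Equiv.Perm (Fin k)) (zx : (Fin k → ℤ) × (Fin s → ℤ)) :
    Kfreq Ψ q (zx.1 ∘ σ, zx.2) = Kfreq Ψ q zx := by
  simp only [Kfreq, tupSum]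
  congr 1
  exact Equiv.sum_comp σ (fun i => sysv Ψ (zx.1 i))

/-- **All coincidence counts are equal**: `#SolZ i j = #SolZ i₀ j₀` for `i ≠ j`, `i₀ ≠ j₀`. [folklore] -/
theorem card_SolZ_eq {i j i₀ j₀ : Fin k} (hij : i ≠ j) (h₀ : i₀ ≠ j₀) :
    (SolZ s P Q Ψ q i j).card = (SolZ s P Q Ψ q i₀ j₀).card := by
  classical
  -- a permutation with `σ i₀ = i`, `σ j₀ = j`
  set σ₁ : Equiv.Perm (Fin k) := Equiv.swap i₀ i with hσ₁
  set σ : Equiv.Perm (Fin k) := σ₁ * Equiv.swap j₀ (σ₁.symm j) with hσ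
  have hσi : σ i₀ = i := by
    rw [hσ, Equiv.Perm.mul_apply]
    have hne1 : i₀ ≠ σ₁.symm j := by
      intro e; apply hij
      have : σ₁ i₀ = j := by rw [e]; simp
      rw [hσ₁, Equiv.swap_apply_left] at this; exact this
    rw [Equiv.swap_apply_of_ne_of_ne h₀ hne1, hσ₁, Equiv.swap_apply_left]
  have hσj : σ j₀ = j := by
    rw [hσ, Equiv.Perm.mul_apply, Equiv.swap_apply_left]; simp
  -- the bijection `a ↦ (z ∘ σ, x), (w ∘ σ, y)` from `SolZ i j` to `SolZ i₀ j₀`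
  refine card_bij' (fun a _ => ((a.1.1 ∘ σ, a.1.2), (a.2.1 ∘ σ, a.2.2)))
    (fun a _ => ((a.1.1 ∘ σ.symm, a.1.2), (a.2.1 ∘ σ.symm, a.2.2))) ?_ ?_ ?_ ?_
  · intro a ha
    rw [SolZ, mem_filter, mem_Sol] at ha ⊢
    refine ⟨⟨⟨comp_perm_mem_KI s P Q ha.1.1.1, comp_perm_mem_KI s P Q ha.1.1.2⟩, ?_⟩, ?_⟩
    · rw [Kfreq_comp_perm, Kfreq_comp_perm]; exact ha.1.2
    · simp only [Function.comp_apply, hσi, hσj]; exact ha.2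
  · intro a ha
    rw [SolZ, mem_filter, mem_Sol] at ha ⊢
    refine ⟨⟨⟨comp_perm_mem_KI s P Q ha.1.1.1, comp_perm_mem_KI s P Q ha.1.1.2⟩, ?_⟩, ?_⟩
    · rw [Kfreq_comp_perm, Kfreq_comp_perm]; exact ha.1.2
    · simp only [Function.comp_apply]
      rw [show σ.symm i = i₀ by rw [← hσi]; simp, show σ.symm j = j₀ by rw [← hσj]; simp]
      exact ha.2
  · intro a _; ext <;> simp
  · intro a _; ext <;> simp

/-- **`S₂` by a union bound**: `#(Sol \ S₁) ≤ k(k−1)·#SolZ 0 1` (`k ≥ 2`). [cite: Ford2002, proof of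
Lemma 3.2 ("K ≤ 2S₂ ≤ 4 C(k,2) ∫ …")] -/
theorem card_S2_le (i₀ j₀ : Fin k) (h₀ : i₀ ≠ j₀) :
    ((Sol s P Q Ψ q).filter fun a => ¬ (Function.Injective a.1.1 ∧ Function.Injective a.2.1)).card
      ≤ k * (k - 1) * (SolZ s P Q Ψ q i₀ j₀).card := by
  classical
  set pairs := (univ : Finset (Fin k × Fin k)).filter fun p => p.1 < p.2 with hpairs
  have hcover : ((Sol s P Q Ψ q).filter fun a => ¬ (Function.Injective a.1.1 ∧ Function.Injective a.2.1))
      ⊆ pairs.biUnion fun p => SolZ s P Q Ψ q p.1 p.2 ∪ SolW s P Q Ψ q p.1 p.2 := by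
    intro a ha
    rw [mem_filter] at ha
    rw [mem_biUnion]
    rcases not_and_or.1 ha.2 with h1 | h1
    · obtain ⟨i, j, hne, hij⟩ := Function.not_injective_iff.1 h1
      rcases lt_or_gt_of_ne hij with hlt | hlt
      · exact ⟨(i, j), by simp [hpairs, hlt], mem_union_left _ (by rw [SolZ, mem_filter]; exact ⟨ha.1, hne⟩)⟩
      · exact ⟨(j, i), by simp [hpairs, hlt], mem_union_left _ (by rw [SolZ, mem_filter]; exact ⟨ha.1, hne.symm⟩)⟩
    · obtain ⟨i, j, hne, hij⟩ := Function.not_injective_iff.1 h1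
      rcases lt_or_gt_of_ne hij with hlt | hlt
      · exact ⟨(i, j), by simp [hpairs, hlt], mem_union_right _ (by rw [SolW, mem_filter]; exact ⟨ha.1, hne⟩)⟩
      · exact ⟨(j, i), by simp [hpairs, hlt], mem_union_right _ (by rw [SolW, mem_filter]; exact ⟨ha.1, hne.symm⟩)⟩
  refine (card_le_card hcover).trans ?_
  refine card_biUnion_le.trans ?_
  have hterm : ∀ p ∈ pairs, (SolZ s P Q Ψ q p.1 p.2 ∪ SolW s P Q Ψ q p.1 p.2).card
      ≤ 2 * (SolZ s P Q Ψ q i₀ j₀).card := by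
    intro p hp
    rw [hpairs, mem_filter] at hp
    have hne : p.1 ≠ p.2 := ne_of_lt hp.2
    refine (card_union_le _ _).trans ?_
    rw [card_SolW_eq, card_SolZ_eq s P Q Ψ q hne h₀]; omega
  refine (sum_le_sum hterm).trans ?_
  rw [sum_const, smul_eq_mul]
  -- `#pairs = k(k−1)/2`
  have hpc : pairs.card * 2 ≤ k * (k - 1) := by
    -- `pairs` injects into off-diagonal ordered pairs twice… we use `pairs ⊔ swap(pairs) ⊆ offDiag`
    have h1 : (pairs.card : ℕ) + pairs.card ≤ ((univ : Finset (Fin k)).offDiag).card := by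
      have hdisj : Disjoint pairs (pairs.map ⟨Prod.swap, Prod.swap_injective⟩) := by
        rw [disjoint_left]; intro p hp hp'
        rw [hpairs, mem_filter] at hp
        rw [mem_map] at hp'
        obtain ⟨p', hp', he⟩ := hp'
        rw [hpairs, mem_filter] at hp'
        rw [← he] at hp
        simp at hp; omega
      have hsub : pairs ∪ pairs.map ⟨Prod.swap, Prod.swap_injective⟩ ⊆ (univ : Finset (Fin k)).offDiag := by
        intro p hp
        rw [mem_union] at hp
        rw [mem_offDiag]
        rcases hp with hp | hp
        · rw [hpairs, mem_filter] at hp; exact ⟨mem_univ _, mem_univ _, ne_of_lt hp.2⟩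
        · rw [mem_map] at hp; obtain ⟨p', hp', rfl⟩ := hp
          rw [hpairs, mem_filter] at hp'
          exact ⟨mem_univ _, mem_univ _, (ne_of_lt hp'.2).symm⟩
      have := card_le_card hsub
      rw [card_union_of_disjoint hdisj, card_map] at this
      exact this
    rw [offDiag_card, card_univ, Fintype.card_fin] at h1
    have e : k * k - k = k * (k - 1) := by
      rcases k with _ | k
      · simp
      · simp [Nat.mul_succ]
    omega
  calc pairs.card * (2 * (SolZ s P Q Ψ q i₀ j₀).card) = pairs.card * 2 * (SolZ s P Q Ψ q i₀ j₀).card := by ring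
    _ ≤ k * (k - 1) * (SolZ s P Q Ψ q i₀ j₀).card := Nat.mul_le_mul_right _ hpc

end SolSets

/-! ### The coincidence count as an integral -/

section Coincidence

variable {k' : ℕ} (s P Q : ℕ) (Ψ : PSystem (k' + 2)) (q : ℤ)

/-- **`N ≤ ∫ |F₂| |F|^{2k−2} |f|^{2s}`** for the number `N` of solutions with `z_0 = z_1` (`k = k'+2`).
[cite: Ford2002, proof of Lemma 3.2 ("2S₂ ≤ 4 C(k,2) ∫ |F^{2k−2} F(2α) f^{2s}| dα")] -/
theorem card_SolZ01_le_integral :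
    ((SolZ s P Q Ψ q 0 1).card : ℝ)
      ≤ ∫ α in box (k' + 2), absF2 P Ψ α * absF P Ψ α ^ (2 * (k' + 2) - 2) * absf Q q α ^ (2 * s) := by
  classical
  set IP := Finset.Icc 1 (P : ℤ) with hIP
  set IQ := Finset.Icc 1 (Q : ℤ) with hIQ
  -- the auxiliary index set `A' = (I_P × I_P^{k'}) × I_Q^s` with doubled first variable
  set A' := (IP ×ˢ tuples k' IP) ×ˢ tuples s IQ with hA'
  set v₁ : ℤ × (Fin k' → ℤ) → Fin (k' + 2) → ℤ := fun yz => sysv (doubleSys Ψ) yz.1 + tupSum (sysv Ψ) yz.2 with hv₁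
  set v' : (ℤ × (Fin k' → ℤ)) × (Fin s → ℤ) → Fin (k' + 2) → ℤ :=
    fun w => v₁ w.1 + tupSum (powv (k' + 2) q) w.2 with hv'
  -- Step 1: injection `SolZ 0 1 ↪ {(b,a') ∈ A' × KI : v' b = Kfreq a'}`
  have hinj : (SolZ s P Q Ψ q 0 1).card
      ≤ ((A' ×ˢ KI (k' + 2) s P Q).filter fun ba => v' ba.1 = Kfreq Ψ q ba.2).card := by
    refine card_le_card_of_injOn (fun a => (((a.1.1 0, fun i => a.1.1 i.succ.succ), a.1.2), a.2)) ?_ ?_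
    · intro a ha
      rw [mem_coe, SolZ, mem_filter, mem_Sol] at ha
      obtain ⟨⟨⟨ha1, ha2⟩, heq⟩, h01⟩ := ha
      rw [mem_KI] at ha1
      rw [mem_coe, mem_filter, mem_product, hA', mem_product, mem_product, mem_tuples, mem_tuples]
      refine ⟨⟨⟨⟨ha1.1 0, fun i => ha1.1 _⟩, ha1.2⟩, ha2⟩, ?_⟩
      rw [← heq]
      simp only [hv', hv₁, Kfreq]
      congr 1
      -- `tupSum sysv z = 2•sysv(z 0) + ∑_{i ≥ 2}` using `z 0 = z 1`
      simp only [tupSum, sysv_doubleSys]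
      rw [Fin.sum_univ_succ, Fin.sum_univ_succ, h01, two_smul]
      simp only [Fin.succ_zero_eq_one]
      abel
    · intro a ha b hb hab
      rw [mem_coe, SolZ, mem_filter] at ha hb
      simp only [Prod.mk.injEq] at hab
      obtain ⟨⟨⟨hy, hzt⟩, hx⟩, ha'⟩ := hab
      refine Prod.ext (Prod.ext ?_ hx) ha'
      funext i
      refine Fin.cases ?_ (fun i => ?_) i
      · exact hy
      · refine Fin.cases ?_ (fun i => ?_) i
        · show a.1.1 1 = b.1.1 1
          rw [← ha.2, ← hb.2]; exact hy
        · exact congrFun hzt i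
  -- Step 2: that pair count is `∫ tp_{A'} conj(tp_{KI})`, bounded by `∫ |⋯|`
  have hcount := integral_tp_mul_conj_tp (n := k' + 2) A' (KI (k' + 2) s P Q) v' (Kfreq Ψ q)
  have htpA : ∀ α, tp A' v' α = tp IP (sysv (doubleSys Ψ)) α * tp IP (sysv Ψ) α ^ k' * tp IQ (powv (k' + 2) q) α ^ s := by
    intro α
    rw [hA', hv', ← tp_mul, hv₁, ← tp_mul, tp_tuples_tupSum, tp_tuples_tupSum]
  have htpB : ∀ α, tp (KI (k' + 2) s P Q) (Kfreq Ψ q) α = tp IP (sysv Ψ) α ^ (k' + 2) * tp IQ (powv (k' + 2) q) α ^ s := by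
    intro α
    have e : tp (KI (k' + 2) s P Q) (Kfreq Ψ q) α
        = tp (tuples (k' + 2) IP) (tupSum (sysv Ψ)) α * tp (tuples s IQ) (tupSum (powv (k' + 2) q)) α := by
      rw [tp_mul]; rfl
    rw [e, tp_tuples_tupSum, tp_tuples_tupSum]
  have hnorm : ∀ α, ‖tp A' v' α * conj (tp (KI (k' + 2) s P Q) (Kfreq Ψ q) α)‖
      = absF2 P Ψ α * absF P Ψ α ^ (2 * (k' + 2) - 2) * absf Q q α ^ (2 * s) := by
    intro α
    rw [norm_mul, Complex.norm_conj, htpA, htpB]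
    simp only [norm_mul, norm_pow, absF2, absF, absf]
    rw [show 2 * (k' + 2) - 2 = k' + (k' + 2) by omega]; ring
  have step2 : ((((A' ×ˢ KI (k' + 2) s P Q).filter fun ba => v' ba.1 = Kfreq Ψ q ba.2).card : ℕ) : ℝ)
      ≤ ∫ α in box (k' + 2), absF2 P Ψ α * absF P Ψ α ^ (2 * (k' + 2) - 2) * absf Q q α ^ (2 * s) := by
    have h1 : ((((A' ×ˢ KI (k' + 2) s P Q).filter fun ba => v' ba.1 = Kfreq Ψ q ba.2).card : ℕ) : ℝ)
        = ‖∫ α in box (k' + 2), tp A' v' α * conj (tp (KI (k' + 2) s P Q) (Kfreq Ψ q) α)‖ := by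
      rw [hcount]; simp
    rw [h1]
    refine (norm_integral_le_integral_norm _).trans (le_of_eq ?_)
    exact setIntegral_congr_fun (measurableSet_box _) fun α _ => hnorm α
  calc ((SolZ s P Q Ψ q 0 1).card : ℝ) ≤ _ := by exact_mod_cast hinj
    _ ≤ _ := step2

/-- **Ford's bound for the coincidence count**: `N ≤ K^{1−1/k}(K(2Ψ) J_{s,k}(Q))^{1/(2k)}`.
[cite: Ford2002, proof of Lemma 3.2 (case `S₂ ≥ S₁`)] -/
theorem coincidence_le {q} (hq : q ≠ 0) :
    ((SolZ s P Q Ψ q 0 1).card : ℝ)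
      ≤ (Ks s P Q Ψ q : ℝ) ^ (1 - 1 / ((k' : ℝ) + 2))
        * (Ks s P Q (doubleSys Ψ) q : ℝ) ^ (1 / (2 * ((k' : ℝ) + 2)))
        * (J (k' + 2) s (Finset.Icc 1 (Q : ℤ)) : ℝ) ^ (1 / (2 * ((k' : ℝ) + 2))) := by
  have h := card_SolZ01_le_integral s P Q Ψ q
  have h3 := holder_three (n := k' + 2) (k := k' + 2) (s := s) (by omega) (continuous_absF P Ψ)
    (continuous_absF2 P Ψ) (continuous_absf Q q) (absF_nonneg P Ψ) (absF2_nonneg P Ψ) (absf_nonneg Q q)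
  rw [← Ks_eq_integral', ← Ks_double_eq_integral, ← J_eq_integral_absf s Q (k := k' + 2) hq] at h3
  push_cast at h3
  exact h.trans h3

end Coincidence

/-! ### `K ≤ 2 S₁` for a maximal system -/

/-- `J_{s,k}([1,Q]) ≥ 1` for `Q ≥ 1` (the diagonal). [folklore] -/
theorem one_le_J (k s Q : ℕ) (hQ : 1 ≤ Q) : 1 ≤ J k s (Finset.Icc 1 (Q : ℤ)) := by
  classical
  have h1 := FordVK.card_pow_mul_J_le k s 0 (Finset.Icc 1 (Q : ℤ))
  rw [add_zero] at h1
  have hJ0 : 1 ≤ J k 0 (Finset.Icc 1 (Q : ℤ)) := by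
    unfold J Jc
    refine Finset.card_pos.2 ⟨(finZeroElim, finZeroElim), ?_⟩
    rw [mem_filter, mem_product, mem_tuples]
    refine ⟨⟨fun i => Fin.elim0 i, fun i => Fin.elim0 i⟩, ?_⟩
    funext j; simp [psv]
  have hI : 1 ≤ (Finset.Icc 1 (Q : ℤ)).card ^ s := by
    refine Nat.one_le_pow _ _ ?_
    rw [Int.card_Icc]; simp; omega
  calc 1 ≤ (Finset.Icc 1 (Q : ℤ)).card ^ s * J k 0 (Finset.Icc 1 (Q : ℤ)) := by
        calc 1 ≤ (Finset.Icc 1 (Q : ℤ)).card ^ s := hI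
          _ ≤ _ := Nat.le_mul_of_pos_right _ hJ0
    _ ≤ _ := h1

set_option maxHeartbeats 800000 in
/-- **`K ≤ 2 S₁`** when `P > 4k⁴` and `K(2Ψ) ≤ K(Ψ)` (which holds for a maximiser of `K` over the
systems of type `(d,T)`): otherwise Hölder and the diagonal `K ≥ P^k J_{s,k}(Q)` contradict each
other. [cite: Ford2002, proof of Lemma 3.2 ("We have a contradiction, therefore K ≤ 2S₁")] -/
theorem Ks_le_two_S1 {k' : ℕ} (s P Q : ℕ) (Ψ : PSystem (k' + 2)) {q : ℤ} (hq : q ≠ 0) (hQ : 1 ≤ Q)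
    (hP : 4 * (k' + 2) ^ 4 < P) (hmax : Ks s P Q (doubleSys Ψ) q ≤ Ks s P Q Ψ q) :
    Ks s P Q Ψ q ≤ 2 * (Sol1 s P Q Ψ q).card := by
  classical
  -- gather the combinatorial facts
  have hsplit : Ks s P Q Ψ q = (Sol1 s P Q Ψ q).card
      + ((Sol s P Q Ψ q).filter fun a => ¬ (Function.Injective a.1.1 ∧ Function.Injective a.2.1)).card := by
    rw [← card_Sol, Sol1]
    exact (Finset.card_filter_add_card_filter_not (s := Sol s P Q Ψ q)
      (fun a => Function.Injective a.1.1 ∧ Function.Injective a.2.1)).symm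
  have hS2 := card_S2_le s P Q Ψ q (0 : Fin (k' + 2)) 1 (by simp)
  have hNle := coincidence_le s P Q Ψ hq
  have hdiag := Ks_ge_diag s P Q Ψ hq (k := k' + 2)
  have hJ1 := one_le_J (k' + 2) s Q hQ
  -- abbreviations
  set K := Ks s P Q Ψ q with hKdef
  set K₂ := Ks s P Q (doubleSys Ψ) q with hK₂def
  set S1 := (Sol1 s P Q Ψ q).card with hS1
  set N := (SolZ s P Q Ψ q 0 1).card with hN
  set Js := J (k' + 2) s (Finset.Icc 1 (Q : ℤ)) with hJs
  by_contra hcon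
  push Not at hcon
  -- then `K < 2 S₂ ≤ 2k(k−1) N`
  have hK2 : K ≤ 2 * ((k' + 2) * (k' + 2 - 1) * N) := by omega
  have hPpos : 0 < P := by omega
  have hKpos : 0 < K := lt_of_lt_of_le (Nat.mul_pos (pow_pos hPpos _) hJ1) hdiag
  -- pass to the reals; write `kk` for the real number `k' + 2`
  set kk : ℝ := (k' : ℝ) + 2 with hkk
  have hKR : (0 : ℝ) < K := by exact_mod_cast hKpos
  have hJR : (1 : ℝ) ≤ Js := by exact_mod_cast hJ1
  have hk2 : (2 : ℝ) ≤ kk := by rw [hkk]; have := (Nat.cast_nonneg k' : (0:ℝ) ≤ k'); linarith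
  have hk0 : (0 : ℝ) < kk := by linarith
  have hmaxR : (K₂ : ℝ) ≤ K := by exact_mod_cast hmax
  have hkkN : ((k' + 2 : ℕ) : ℝ) = kk := by rw [hkk]; push_cast; ring_nf
  -- `N ≤ K^{1−1/2k} J^{1/2k}`
  have hN2 : (N : ℝ) ≤ (K : ℝ) ^ (1 - 1 / (2 * (kk : ℝ))) * (Js : ℝ) ^ (1 / (2 * (kk : ℝ))) := by
    refine hNle.trans ?_
    have h1 : (K₂ : ℝ) ^ (1 / (2 * (kk : ℝ))) ≤ (K : ℝ) ^ (1 / (2 * (kk : ℝ))) :=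
      Real.rpow_le_rpow (by positivity) hmaxR (by positivity)
    calc (K : ℝ) ^ (1 - 1 / (kk : ℝ)) * (K₂ : ℝ) ^ (1 / (2 * (kk : ℝ))) * (Js : ℝ) ^ (1 / (2 * (kk : ℝ)))
        ≤ (K : ℝ) ^ (1 - 1 / (kk : ℝ)) * (K : ℝ) ^ (1 / (2 * (kk : ℝ))) * (Js : ℝ) ^ (1 / (2 * (kk : ℝ))) := by
          gcongr
      _ = (K : ℝ) ^ (1 - 1 / (2 * (kk : ℝ))) * (Js : ℝ) ^ (1 / (2 * (kk : ℝ))) := by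
          rw [← Real.rpow_add hKR]; congr 1; field_simp; ring_nf
  have hcoef0 : (0 : ℝ) ≤ 2 * ((kk : ℝ) * (kk - 1)) := by nlinarith
  have hK2R : (K : ℝ) ≤ 2 * ((kk : ℝ) * (kk - 1)) * ((K : ℝ) ^ (1 - 1 / (2 * (kk : ℝ))) * (Js : ℝ) ^ (1 / (2 * (kk : ℝ)))) := by
    have h1 : (K : ℝ) ≤ 2 * ((kk : ℝ) * (kk - 1)) * N := by
      have : (K : ℝ) ≤ ((2 * ((k' + 2) * (k' + 2 - 1) * N) : ℕ) : ℝ) := by exact_mod_cast hK2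
      rw [Nat.cast_mul, Nat.cast_mul, Nat.cast_mul, Nat.cast_sub (by omega)] at this
      push_cast at this; rw [hkk]; linarith
    exact h1.trans (mul_le_mul_of_nonneg_left hN2 hcoef0)
  -- divide by `K^{1−1/2k}` and raise to the power `2k`
  have hKroot : (K : ℝ) ^ (1 / (2 * (kk : ℝ))) ≤ 2 * ((kk : ℝ) * (kk - 1)) * (Js : ℝ) ^ (1 / (2 * (kk : ℝ))) := by
    have e : (K : ℝ) = (K : ℝ) ^ (1 - 1 / (2 * (kk : ℝ))) * (K : ℝ) ^ (1 / (2 * (kk : ℝ))) := by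
      rw [← Real.rpow_add hKR]; simp
    have hpos : 0 < (K : ℝ) ^ (1 - 1 / (2 * (kk : ℝ))) := Real.rpow_pos_of_pos hKR _
    have h2 : (K : ℝ) ^ (1 - 1 / (2 * (kk : ℝ))) * (K : ℝ) ^ (1 / (2 * (kk : ℝ)))
        ≤ (K : ℝ) ^ (1 - 1 / (2 * (kk : ℝ))) * (2 * ((kk : ℝ) * (kk - 1)) * (Js : ℝ) ^ (1 / (2 * (kk : ℝ)))) := by
      calc (K : ℝ) ^ (1 - 1 / (2 * (kk : ℝ))) * (K : ℝ) ^ (1 / (2 * (kk : ℝ))) = K := e.symm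
        _ ≤ _ := hK2R
        _ = _ := by ring_nf
    exact le_of_mul_le_mul_left h2 hpos
  have hKle : (K : ℝ) ≤ (2 * (kk * (kk - 1))) ^ (2 * (k' + 2)) * Js := by
    have h1 := pow_le_pow_left₀ (Real.rpow_nonneg hKR.le _) hKroot (2 * (k' + 2))
    rw [← Real.rpow_natCast ((K : ℝ) ^ _), ← Real.rpow_mul hKR.le, mul_pow, ← Real.rpow_natCast ((Js : ℝ) ^ _),
      ← Real.rpow_mul (by positivity)] at h1
    have e : 1 / (2 * kk) * ((2 * (k' + 2) : ℕ) : ℝ) = 1 := by rw [hkk]; push_cast; field_simp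
    rw [e, Real.rpow_one, Real.rpow_one] at h1
    exact h1
  -- but `K ≥ P^k J` and `P > 4k⁴ ≥ (2k(k−1))²`
  have hdiagR : (P : ℝ) ^ (k' + 2) * Js ≤ K := by exact_mod_cast hdiag
  have hPk : ((2 * (kk * (kk - 1))) ^ 2) < P := by
    have hP' : ((4 * (k' + 2) ^ 4 : ℕ) : ℝ) < P := by exact_mod_cast hP
    push_cast at hP'
    have : (2 * (kk * (kk - 1))) ^ 2 ≤ 4 * ((k' : ℝ) + 2) ^ 4 := by rw [hkk]; nlinarith
    linarith
  have hlt : (2 * (kk * (kk - 1))) ^ (2 * (k' + 2)) < (P : ℝ) ^ (k' + 2) := by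
    rw [pow_mul]; exact pow_lt_pow_left₀ hPk (by positivity) (by omega)
  have hJpos : (0 : ℝ) < Js := by linarith
  have := mul_lt_mul_of_pos_right hlt hJpos
  linarith

/-! ### `S₁ ≤ ∑_{p ∈ 𝒫} S₃(p)` -/

section S3

variable {k : ℕ}

/-- The first `n` coordinates of `z ∈ ℤ^k` (`n ≤ k`). [folklore] -/
def headN {n : ℕ} (hn : n ≤ k) (z : Fin k → ℤ) : Fin n → ℤ := fun i => z (Fin.castLE hn i)

/-- `S₃(p)`: the solutions with `p ∤ J_n(z|ₙ;Ψ) J_n(w|ₙ;Ψ)`. [cite: Ford2002, proof of Lemma 3.2 ((3.3))] -/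
def Sol3 (s P Q : ℕ) (Ψ : PSystem k) (q : ℤ) (d n : ℕ) (hnd : n + d ≤ k) (p : ℕ) :
    Finset (((Fin k → ℤ) × (Fin s → ℤ)) × ((Fin k → ℤ) × (Fin s → ℤ))) :=
  (Sol s P Q Ψ q).filter fun a =>
    ¬ ((p : ℤ) ∣ jac Ψ d n hnd (headN (by omega) a.1.1)) ∧ ¬ ((p : ℤ) ∣ jac Ψ d n hnd (headN (by omega) a.2.1))

/-- **The prime pigeonhole** `S₁ ≤ ∑_{p ∈ 𝒫} S₃(p)`: for a system of type `(d,T)` and a set `𝒫` of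
primes `> k` with `T (P−1)^{n(n−1)} < ∏ 𝒫`, every solution with injective `z, w` is counted by
some `S₃(p)`. [cite: Ford2002, proof of Lemma 3.2 ((3.3): "K ≤ 2k³ max_p S₃(p)")] -/
theorem card_Sol1_le_sum_Sol3 (s P Q : ℕ) (Ψ : PSystem k) (q : ℤ) (d n : ℕ) (hnd : n + d ≤ k)
    {T m : ℕ} (hΨ : IsType Ψ d T m) (hT : 1 ≤ T) (hk : 2 ≤ k)
    {Ps : Finset ℕ} (hPs : ∀ p ∈ Ps, p.Prime ∧ k < p)
    (hprod : T * (P - 1) ^ (n * (n - 1)) < ∏ p ∈ Ps, p) :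
    (Sol1 s P Q Ψ q).card ≤ ∑ p ∈ Ps, (Sol3 s P Q Ψ q d n hnd p).card := by
  classical
  have hcover : Sol1 s P Q Ψ q ⊆ Ps.biUnion fun p => Sol3 s P Q Ψ q d n hnd p := by
    intro a ha
    rw [Sol1, mem_filter, mem_Sol] at ha
    obtain ⟨⟨⟨ha1, ha2⟩, heq⟩, hinjz, hinjw⟩ := ha
    rw [mem_KI] at ha1 ha2
    set u := headN (show n ≤ k by omega) a.1.1 with hu
    set u' := headN (show n ≤ k by omega) a.2.1 with hu'
    have huinj : Function.Injective u := fun i j h => Fin.castLE_injective _ (hinjz h)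
    have hu'inj : Function.Injective u' := fun i j h => Fin.castLE_injective _ (hinjw h)
    have humem : ∀ i, u i ∈ Finset.Icc (1 : ℤ) P := fun i => ha1.1 _
    have hu'mem : ∀ i, u' i ∈ Finset.Icc (1 : ℤ) P := fun i => ha2.1 _
    -- `D = T · vdm u · vdm u' < ∏ Ps`
    set D := T * (vdm u * vdm u') with hD
    have hD0 : D ≠ 0 := mul_ne_zero (by omega) (mul_ne_zero (vdm_ne_zero huinj) (vdm_ne_zero hu'inj))
    have hDlt : D < ∏ p ∈ Ps, p := by
      have h1 := vdm_le humem
      have h2 := vdm_le hu'mem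
      have e : n * (n - 1) / 2 + n * (n - 1) / 2 = n * (n - 1) := by
        have := Nat.two_mul_div_two_of_even (Nat.even_mul_pred_self n); omega
      have : vdm u * vdm u' ≤ (P - 1) ^ (n * (n - 1)) := by
        calc vdm u * vdm u' ≤ (P - 1) ^ (n * (n - 1) / 2) * (P - 1) ^ (n * (n - 1) / 2) := Nat.mul_le_mul h1 h2
          _ = (P - 1) ^ (n * (n - 1)) := by rw [← pow_add, e]
      calc D ≤ T * (P - 1) ^ (n * (n - 1)) := Nat.mul_le_mul_left _ this
        _ < _ := hprod
    -- some `p ∈ Ps` does not divide `D`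
    have hex : ∃ p ∈ Ps, ¬ p ∣ D := by
      by_contra hall
      push Not at hall
      have hprimes : ∀ p ∈ Ps, Prime p := fun p hp => (hPs p hp).1.prime
      have := Nat.le_of_dvd (Nat.pos_of_ne_zero hD0) (Finset.prod_primes_dvd D hprimes hall)
      omega
    obtain ⟨p, hp, hpD⟩ := hex
    rw [mem_biUnion]
    refine ⟨p, hp, ?_⟩
    have hpT : ¬ p ∣ T := fun h => hpD (dvd_mul_of_dvd_left h _)
    have hpu : ∀ i j : Fin n, i ≠ j → ¬ ((p : ℤ) ∣ u i - u j) := fun i j hij h =>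
      hpD (dvd_mul_of_dvd_right (dvd_mul_of_dvd_left (dvd_vdm_of_dvd_sub hij h) _) _)
    have hpu' : ∀ i j : Fin n, i ≠ j → ¬ ((p : ℤ) ∣ u' i - u' j) := fun i j hij h =>
      hpD (dvd_mul_of_dvd_right (dvd_mul_of_dvd_right (dvd_vdm_of_dvd_sub hij h) _) _)
    have hp2 : p ≠ 2 := by have := (hPs p hp).2; omega
    rw [Sol3, mem_filter, mem_Sol]
    refine ⟨⟨⟨by rw [mem_KI]; exact ha1, by rw [mem_KI]; exact ha2⟩, heq⟩, ?_, ?_⟩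
    · exact prime_not_dvd_jac hΨ hnd (hPs p hp).1 (hPs p hp).2 hp2 hpT hpu
    · exact prime_not_dvd_jac hΨ hnd (hPs p hp).1 (hPs p hp).2 hp2 hpT hpu'
  exact (card_le_card hcover).trans card_biUnion_le

end S3

end FordVK
end Literature.NumberTheory.LFunctions
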